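import Literature.NumberTheory.Rogawski1990.ArchExplicitTransferFactor
import HarnessLib

/-!
# `Δ″_∞(γ_H, yγ′y⁻¹) = Δ″_∞(γ_H, γ′)`: Rogawski's explicit archimedean transfer factor is a class function of `γ′ ∈ G′_∞`
# (node N1a-r of `F0/P3a/T6b-TREE.md`; the `hr` hypothesis of ★ `archExplicitTransferFactor` DISCHARGED)

Topic `NumberTheory/Rogawski1990`; namespace `Literature.NumberTheory.Rogawski1990`.  THEOREMS ONLY (no `def`, no named fact, no
`sorry`, no instance, no notation); sibling of ★ `ArchExplicitTransferFactor.lean` (typ-T6b, ED. 2 p826446), imports it and nothing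
else of the tree.  Cell `pub/hodgecm-mathlib`, F0∕P3a, typer topic T6, seat B-p12 (g25).  HONEST LABEL: HC_CM is proved only modulo the
printed citations («named inputs remaining 2») until rung 0 closes; this file proves nothing of them — it turns the second
conjugation-invariance HYPOTHESIS `hr` of ★ `archExplicitTransferFactor L H′ μ hl hr : ArchTransferFactor L H′` into a theorem, so that
`archExplicitTransferFactor L H′ μ (archExplicitDelta_conj_left L H′ μ) (archExplicitDelta_conj_right L H′ μ)` is print's factor
`Δ″_∞` as an UNCONDITIONAL ★ `ArchTransferFactor` (★ `TransferFactorData`: support on matching pairs + invariance in both variables).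

THE MATHEMATICS (Rogawski 1990 §4.9 p. 55, §14.6 p. 242; Langlands–Shelstad 1987 §2: a transfer factor depends only on the
conjugacy class of `γ′` in `G′`).  `Δ″_∞(γ_H, γ′) = τ(γ_H) · D_{G∕H,∞}(γ_H) · Π_w κ_w(γ_H, γ′)` on matching pairs `ι(γ_H) ↔ γ′`, `0` off
them (★ `archExplicitDelta`); only `κ_w(γ_H, γ′) = sgn Re tr(P_wᴴ · w(H′) · P_w) · η_w(H′)` sees `γ′`, through
`P_w = χ_{g_w}(γ′_w) = γ′_w² − tr(g_w)γ′_w + det(g_w)` (★ `archEigenlineProjector`).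
* §1 (pure matrix algebra over `ℂ`): for a RANK-ONE matrix `P = s · p qᵀ` and any `A`,
  `tr((PA)ᴴ H (PA)) = (s̄s) · ((qA)ᴴ(qA)) · (pᴴ H p)` — the first two factors are non-negative reals, the second vanishes iff `qA = 0`,
  i.e. iff `q = 0` when `A` is invertible; hence `sgn Re tr((PA)ᴴ H (PA)) = sgn Re tr(Pᴴ H P)` (`sign_re_trace_rankOne_mul_eq`).
* §2: `P_w(γ_H, yγ′y⁻¹) = y_w · P_w(γ_H, γ′) · y_w⁻¹` (a polynomial in `γ′_w`); `y_wᴴ · w(H′) · y_w = w(H′)` (membership in ★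
  `UnitaryGroup.arch`, read at `w` by ★ `UnitaryGroup.archAt` ∕ ★ `mem_archLocal_iff_conjTranspose`), so
  `tr(P′ᴴ w(H′) P′) = tr((P y_w⁻¹)ᴴ · w(H′) · (P y_w⁻¹))`; and ON A MATCHING PAIR `P_w` HAS RANK ≤ 1 with NO regularity hypothesis:
  `γ′ = c·ι(γ_H)·c⁻¹` in `GL₃(L ⊗ ℝ)` (★ `Corresponds` = ambient conjugacy), so `P_w = c_w · χ_{g_w}(ι(γ_H)_w) · c_w⁻¹` and
  `χ_{g_w}(ι(g, γ₂)_w) = 0 ⊕ χ_{g_w}(γ₂)` by Cayley–Hamilton on the `g_w`-block (`ι` = the pattern `(* 0 *; 0 γ₂ 0; * 0 *)`, ★ `coe_endoGL_eq`)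
  — a single non-zero entry, i.e. `P_w = (c_w e₂)(χ_{g_w}(γ₂) e₂ᵀ c_w⁻¹)` (`archEigenlineProjector_eq_vecMulVec_of_isArchNormPair`).
* §3: `κ_w(γ_H, yγ′y⁻¹) = κ_w(γ_H, γ′)` on matching pairs (`archKappaAt_conj_right`), matching itself is a class function of `γ′`
  (`isArchNormPair_conj_right`, ★ `Corresponds.of_isStablyConj_right`), hence the head **`archExplicitDelta_conj_right`** — the type of
  `hr` TOKEN FOR TOKEN.

## References
* [Rogawski1990] J. D. Rogawski, *Automorphic Representations of Unitary Groups in Three Variables*, Ann. of Math. Stud. 123 (1990):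
  §4.3 p. 43 (transfer factors are class functions in each variable), §4.9 p. 55 (`τ`, `D_{G∕H}`, `Δ_{G∕H}`), §14.6 p. 242 (`Δ″_v`, `κ = ±1`).
* [LanglandsShelstad1987] R. P. Langlands, D. Shelstad, *On the definition of transfer factors*, Math. Ann. 278 (1987), §2 (dependence on
  the conjugacy class of `γ_G` only), §4.2.
-/

set_option autoImplicit false

noncomputable section

open NumberField NumberField.InfinitePlace Matrix Polynomial
open Literature.NumberTheory.GaloisRepresentations
open scoped MatrixGroups ComplexOrder

namespace Literature.NumberTheory.Rogawski1990

open Literature.NumberTheory.Automorphic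

/-! ## §1 Rank-one matrix algebra over `ℂ`: the sign of `Re tr(Pᴴ H P)` is a congruence invariant when `P` has rank `≤ 1` -/

section RankOne

variable {n : Type*} [Fintype n]

/-- `r̄ · r = Σ_i |r_i|²` (as a real number). [folklore] -/
private theorem star_dotProduct_self_eq_ofReal (r : n → ℂ) :
    star r ⬝ᵥ r = ((∑ i, Complex.normSq (r i) : ℝ) : ℂ) := by
  rw [Complex.ofReal_sum]
  simp only [dotProduct, Pi.star_apply, Complex.star_def, Complex.normSq_eq_conj_mul_self]

/-- **Trace of the congruence of a rank-one form**: for `P = s · p qᵀ`,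
`tr((P A)ᴴ H (P A)) = (s̄ s) · ((qA)^† (qA)) · (p^† H p)`. [folklore] -/
private theorem trace_conjTranspose_mul_mul_rankOne_mul (s : ℂ) (p q : n → ℂ) (H A : Matrix n n ℂ) :
    ((s • vecMulVec p q * A)ᴴ * H * (s • vecMulVec p q * A)).trace =
      (starRingEnd ℂ s * s) * (star (q ᵥ* A) ⬝ᵥ (q ᵥ* A)) * (star p ⬝ᵥ H *ᵥ p) := by
  rw [Matrix.smul_mul, vecMulVec_mul, conjTranspose_smul, conjTranspose_vecMulVec, Matrix.smul_mul, Matrix.smul_mul,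
    Matrix.mul_smul, smul_smul, trace_smul, vecMulVec_mul, vecMulVec_mul_vecMulVec, trace_vecMulVec, dotProduct_smul,
    ← dotProduct_mulVec, smul_eq_mul, smul_eq_mul, Complex.star_def]
  ring

/-- The real part of that trace: `|s|² · ‖qA‖² · Re(p^† H p)`. [folklore] -/
private theorem re_trace_conjTranspose_mul_mul_rankOne_mul (s : ℂ) (p q : n → ℂ) (H A : Matrix n n ℂ) :
    ((s • vecMulVec p q * A)ᴴ * H * (s • vecMulVec p q * A)).trace.re =
      Complex.normSq s * (∑ i, Complex.normSq ((q ᵥ* A) i)) * (star p ⬝ᵥ H *ᵥ p).re := by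
  rw [trace_conjTranspose_mul_mul_rankOne_mul, star_dotProduct_self_eq_ofReal, ← Complex.normSq_eq_conj_mul_self,
    ← Complex.ofReal_mul, Complex.re_ofReal_mul]

/-- Two non-negative reals vanishing together have the same sign. [folklore] -/
private theorem sign_eq_sign_of_nonneg_of_iff {u v : ℝ} (hu : 0 ≤ u) (hv : 0 ≤ v) (h : u = 0 ↔ v = 0) :
    SignType.sign u = SignType.sign v := by
  rcases hu.eq_or_lt with hu0 | hu0
  · rw [← hu0, h.1 hu0.symm, sign_zero]
  · have hv0 : 0 < v := lt_of_le_of_ne hv (fun h0 => (hu0.ne' (h.2 h0.symm)))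
    rw [sign_pos hu0, sign_pos hv0]

/-- **`sgn Re tr((PA)ᴴ H (PA)) = sgn Re tr(Pᴴ H P)` for `P = s · p qᵀ` of rank `≤ 1` and `A` (right-)invertible** — the hermitian form
`Pᴴ H P` is a real multiple of the rank-one projector `q qᵀ`-shape, so the sign of its trace survives any congruence. [folklore] -/
private theorem sign_re_trace_rankOne_mul_eq [DecidableEq n] (s : ℂ) (p q : n → ℂ) (H A B : Matrix n n ℂ) (hAB : A * B = 1) :
    SignType.sign ((s • vecMulVec p q * A)ᴴ * H * (s • vecMulVec p q * A)).trace.re =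
      SignType.sign ((s • vecMulVec p q)ᴴ * H * (s • vecMulVec p q)).trace.re := by
  conv_rhs => rw [← Matrix.mul_one (s • vecMulVec p q)]
  rw [re_trace_conjTranspose_mul_mul_rankOne_mul, re_trace_conjTranspose_mul_mul_rankOne_mul, vecMul_one, sign_mul, sign_mul,
    sign_mul, sign_mul]
  congr 2
  refine sign_eq_sign_of_nonneg_of_iff (Finset.sum_nonneg fun i _ => Complex.normSq_nonneg _)
    (Finset.sum_nonneg fun i _ => Complex.normSq_nonneg _) ?_
  have key : ∀ r : n → ℂ, (∑ i, Complex.normSq (r i)) = 0 ↔ r = 0 := by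
    intro r
    rw [← Complex.ofReal_eq_zero, ← star_dotProduct_self_eq_ofReal, dotProduct_star_self_eq_zero]
  rw [key, key]
  constructor
  · intro h
    have : q ᵥ* (A * B) = 0 := by rw [← vecMul_vecMul, h, zero_vecMul]
    rwa [hAB, vecMul_one] at this
  · intro h
    rw [h, zero_vecMul]

/-- **The pattern `ι(g, u) = (g₀₀ 0 g₀₁; 0 u 0; g₁₀ 0 g₁₁)` is killed by `χ_g` off the middle entry** (Cayley–Hamilton for the `2 × 2` block):
`ι² − tr(g)·ι + det(g)·1 = χ_g(u) · E₂₂`, a rank-one matrix. [folklore] -/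
private theorem endoPattern_sq_sub_trace_smul_add_det_smul_one (g : Matrix (Fin 2) (Fin 2) ℂ) (u : ℂ) :
    (!![g 0 0, 0, g 0 1; 0, u, 0; g 1 0, 0, g 1 1] * !![g 0 0, 0, g 0 1; 0, u, 0; g 1 0, 0, g 1 1] -
        g.trace • !![g 0 0, 0, g 0 1; 0, u, 0; g 1 0, 0, g 1 1] + g.det • (1 : Matrix (Fin 3) (Fin 3) ℂ)) =
      vecMulVec (Pi.single 1 (u * u - g.trace * u + g.det)) (Pi.single 1 1) := by
  ext i j
  rw [Matrix.trace_fin_two, Matrix.det_fin_two]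
  fin_cases i <;> fin_cases j <;>
    simp [vecMulVec_apply] <;> ring

/-- Conjugating a quadratic polynomial in a matrix: `(cιc′)² − t·(cιc′) + d = c (ι² − tι + d) c′` when `c′c = 1 = cc′`. [folklore] -/
private theorem conj_mul_sq_sub_smul_add_smul_one {m : Type*} [Fintype m] [DecidableEq m] (c c' ι : Matrix m m ℂ) (t d : ℂ)
    (h1 : c' * c = 1) (h2 : c * c' = 1) :
    c * ι * c' * (c * ι * c') - t • (c * ι * c') + d • (1 : Matrix m m ℂ) = c * (ι * ι - t • ι + d • 1) * c' := by
  have hsq : c * ι * c' * (c * ι * c') = c * (ι * ι) * c' := by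
    calc c * ι * c' * (c * ι * c') = c * ι * (c' * c) * ι * c' := by simp only [Matrix.mul_assoc]
      _ = c * (ι * ι) * c' := by rw [h1, Matrix.mul_one, Matrix.mul_assoc c ι ι]
  rw [hsq]
  simp only [Matrix.mul_sub, Matrix.mul_add, Matrix.sub_mul, Matrix.add_mul, Matrix.mul_smul, Matrix.smul_mul, Matrix.mul_one, h2]

end RankOne

/-! ## §2 `P_w` under conjugation of `γ′`; unitarity at `w`; rank one on matching pairs -/

section ConjRight

variable (L : Type) [Field L] [NumberField L] [IsCMField L] (H' : Matrix (Fin 3) (Fin 3) L)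
  (a : ↥(UnitaryGroup.arch (↥(maximalRealSubfield L)) L (IsCMField.complexConj L) 2
      (Matrix.of fun i j : Fin 2 => if i.val + j.val + 1 = 2 then (1 : L) else 0)) ×
    ↥(UnitaryGroup.arch (↥(maximalRealSubfield L)) L (IsCMField.complexConj L) 1
      (Matrix.of fun i j : Fin 1 => if i.val + j.val + 1 = 1 then (1 : L) else 0)))
  (b y : ↥(UnitaryGroup.arch (↥(maximalRealSubfield L)) L (IsCMField.complexConj L) 3 H'))
  (w : {w : InfinitePlace L // IsComplex w})

/-- `y_w⁻¹ · y_w = 1` for the `w`-coordinates of `y ∈ G′_∞` (bookkeeping). [folklore] -/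
private theorem map_evalC_inv_mul :
    (((y : GL (Fin 3) (mixedEmbedding.mixedSpace L))⁻¹ : GL (Fin 3) (mixedEmbedding.mixedSpace L)) :
          Matrix (Fin 3) (Fin 3) (mixedEmbedding.mixedSpace L)).map (UnitaryGroup.evalC L w) *
        ((y : GL (Fin 3) (mixedEmbedding.mixedSpace L)) : Matrix (Fin 3) (Fin 3) (mixedEmbedding.mixedSpace L)).map
          (UnitaryGroup.evalC L w) = 1 := by
  rw [← Matrix.map_mul, ← Units.val_mul, inv_mul_cancel, Units.val_one,
    Matrix.map_one _ (map_zero (UnitaryGroup.evalC L w)) (map_one (UnitaryGroup.evalC L w))]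

/-- `y_w · y_w⁻¹ = 1` (bookkeeping). [folklore] -/
private theorem map_evalC_mul_inv :
    ((y : GL (Fin 3) (mixedEmbedding.mixedSpace L)) : Matrix (Fin 3) (Fin 3) (mixedEmbedding.mixedSpace L)).map
          (UnitaryGroup.evalC L w) *
        (((y : GL (Fin 3) (mixedEmbedding.mixedSpace L))⁻¹ : GL (Fin 3) (mixedEmbedding.mixedSpace L)) :
          Matrix (Fin 3) (Fin 3) (mixedEmbedding.mixedSpace L)).map (UnitaryGroup.evalC L w) = 1 := by
  rw [← Matrix.map_mul, ← Units.val_mul, mul_inv_cancel, Units.val_one,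
    Matrix.map_one _ (map_zero (UnitaryGroup.evalC L w)) (map_one (UnitaryGroup.evalC L w))]

/-- **`P_w(γ_H, yγ′y⁻¹) = y_w · P_w(γ_H, γ′) · y_w⁻¹`** — `P_w` is a polynomial in `γ′_w`. [cite: Rogawski1990, §14.6 p. 242] -/
theorem archEigenlineProjector_conj_right :
    archEigenlineProjector L H' a w (y * b * y⁻¹) =
      ((y : GL (Fin 3) (mixedEmbedding.mixedSpace L)) : Matrix (Fin 3) (Fin 3) (mixedEmbedding.mixedSpace L)).map
          (UnitaryGroup.evalC L w) *
        archEigenlineProjector L H' a w b *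
        (((y : GL (Fin 3) (mixedEmbedding.mixedSpace L))⁻¹ : GL (Fin 3) (mixedEmbedding.mixedSpace L)) :
          Matrix (Fin 3) (Fin 3) (mixedEmbedding.mixedSpace L)).map (UnitaryGroup.evalC L w) := by
  have hcoe : ((y * b * y⁻¹ : ↥(UnitaryGroup.arch (↥(maximalRealSubfield L)) L (IsCMField.complexConj L) 3 H')) :
      GL (Fin 3) (mixedEmbedding.mixedSpace L)) =
      (y : GL (Fin 3) (mixedEmbedding.mixedSpace L)) * (b : GL (Fin 3) (mixedEmbedding.mixedSpace L)) *
        (y : GL (Fin 3) (mixedEmbedding.mixedSpace L))⁻¹ := by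
    simp only [Subgroup.coe_mul, Subgroup.coe_inv]
  set yw := ((y : GL (Fin 3) (mixedEmbedding.mixedSpace L)) : Matrix (Fin 3) (Fin 3) (mixedEmbedding.mixedSpace L)).map
    (UnitaryGroup.evalC L w) with hyw
  set yw' := (((y : GL (Fin 3) (mixedEmbedding.mixedSpace L))⁻¹ : GL (Fin 3) (mixedEmbedding.mixedSpace L)) :
    Matrix (Fin 3) (Fin 3) (mixedEmbedding.mixedSpace L)).map (UnitaryGroup.evalC L w) with hyw'
  have h1 : yw' * yw = 1 := map_evalC_inv_mul L H' y w
  have h2 : yw * yw' = 1 := map_evalC_mul_inv L H' y w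
  dsimp only [archEigenlineProjector]
  rw [hcoe, Units.val_mul, Units.val_mul, Matrix.map_mul, Matrix.map_mul, ← hyw, ← hyw']
  exact conj_mul_sq_sub_smul_add_smul_one yw yw' _ _ _ h1 h2

/-- **`y_wᴴ · w(H′) · y_w = w(H′)`** for `y ∈ G′_∞ = U(H′)(L⁺ ⊗ ℝ)` at a complex place `w` (★ `UnitaryGroup.archAt` lands in
★ `UnitaryGroup.archLocal`, whose membership is this identity). [cite: PlatonovRapinchuk1994, §2.3] -/
theorem conjTranspose_map_evalC_mul_form_mul :
    (((y : GL (Fin 3) (mixedEmbedding.mixedSpace L)) : Matrix (Fin 3) (Fin 3) (mixedEmbedding.mixedSpace L)).map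
          (UnitaryGroup.evalC L w))ᴴ * H'.map w.1.embedding *
        ((y : GL (Fin 3) (mixedEmbedding.mixedSpace L)) : Matrix (Fin 3) (Fin 3) (mixedEmbedding.mixedSpace L)).map
          (UnitaryGroup.evalC L w) = H'.map w.1.embedding := by
  have hmem := (UnitaryGroup.archAt (↥(maximalRealSubfield L)) L (IsCMField.complexConj L) 3 H' w
      (UnitaryGroup.complexConj_smul_infinitePlace L w.1) (IsCMField.complexConj_ne_one L) y).2
  rw [UnitaryGroup.mem_archLocal_iff_conjTranspose, UnitaryGroup.coe_archAt, Matrix.GeneralLinearGroup.val_map_apply] at hmem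
  exact hmem

/-- **On a matching pair `P_w` has rank `≤ 1`**: `ι(γ_H) ↔ γ′` means `γ′ = c ι(γ_H) c⁻¹` in `GL₃(L ⊗ ℝ)`, and `χ_{g_w}` kills the `g_w`-block
of `ι(γ_H)_w` (Cayley–Hamilton), so `P_w = χ_{g_w}(γ′_w) = (c_w e₂) · (χ_{g_w}(γ₂) e₂ᵀ c_w⁻¹)` — no regularity or semisimplicity
hypothesis. [cite: Rogawski1990, §4.9 p. 55; §14.6 p. 242] -/
theorem archEigenlineProjector_eq_vecMulVec_of_isArchNormPair (h : IsArchNormPair L H' a b) :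
    ∃ p q : Fin 3 → ℂ, archEigenlineProjector L H' a w b = vecMulVec p q := by
  rw [isArchNormPair_iff] at h
  obtain ⟨c, hc⟩ := isConj_iff.1 h
  have hmat : ((b : GL (Fin 3) (mixedEmbedding.mixedSpace L)) : Matrix (Fin 3) (Fin 3) (mixedEmbedding.mixedSpace L)) =
      (c : Matrix (Fin 3) (Fin 3) (mixedEmbedding.mixedSpace L)) *
        (((endoEmbArch L a : ↥(UnitaryGroup.arch (↥(maximalRealSubfield L)) L (IsCMField.complexConj L) 3
            (Matrix.of fun i j : Fin 3 => if i.val + j.val + 1 = 3 then (1 : L) else 0))) :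
            GL (Fin 3) (mixedEmbedding.mixedSpace L)) : Matrix (Fin 3) (Fin 3) (mixedEmbedding.mixedSpace L)) *
        ((c⁻¹ : GL (Fin 3) (mixedEmbedding.mixedSpace L)) : Matrix (Fin 3) (Fin 3) (mixedEmbedding.mixedSpace L)) := by
    rw [← Units.val_mul, ← Units.val_mul, hc]
  set cw := (c : Matrix (Fin 3) (Fin 3) (mixedEmbedding.mixedSpace L)).map (UnitaryGroup.evalC L w) with hcw
  set cw' := ((c⁻¹ : GL (Fin 3) (mixedEmbedding.mixedSpace L)) : Matrix (Fin 3) (Fin 3) (mixedEmbedding.mixedSpace L)).map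
    (UnitaryGroup.evalC L w) with hcw'
  have h1 : cw' * cw = 1 := by
    rw [hcw, hcw', ← Matrix.map_mul, ← Units.val_mul, inv_mul_cancel, Units.val_one,
      Matrix.map_one _ (map_zero (UnitaryGroup.evalC L w)) (map_one (UnitaryGroup.evalC L w))]
  have h2 : cw * cw' = 1 := by
    rw [hcw, hcw', ← Matrix.map_mul, ← Units.val_mul, mul_inv_cancel, Units.val_one,
      Matrix.map_one _ (map_zero (UnitaryGroup.evalC L w)) (map_one (UnitaryGroup.evalC L w))]
  set g := (((a.1 : ↥(UnitaryGroup.arch (↥(maximalRealSubfield L)) L (IsCMField.complexConj L) 2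
      (Matrix.of fun i j : Fin 2 => if i.val + j.val + 1 = 2 then (1 : L) else 0))) :
        GL (Fin 2) (mixedEmbedding.mixedSpace L)) : Matrix (Fin 2) (Fin 2) (mixedEmbedding.mixedSpace L)) with hg
  set u := (((a.2 : ↥(UnitaryGroup.arch (↥(maximalRealSubfield L)) L (IsCMField.complexConj L) 1
      (Matrix.of fun i j : Fin 1 => if i.val + j.val + 1 = 1 then (1 : L) else 0))) :
        GL (Fin 1) (mixedEmbedding.mixedSpace L)) : Matrix (Fin 1) (Fin 1) (mixedEmbedding.mixedSpace L)) with hu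
  -- the `w`-coordinate of `ι(γ_H)` is the pattern of `g_w = g.map φ` and `u_w = φ (u 0 0)`
  have hι : ((((endoEmbArch L a : ↥(UnitaryGroup.arch (↥(maximalRealSubfield L)) L (IsCMField.complexConj L) 3
            (Matrix.of fun i j : Fin 3 => if i.val + j.val + 1 = 3 then (1 : L) else 0))) :
            GL (Fin 3) (mixedEmbedding.mixedSpace L)) : Matrix (Fin 3) (Fin 3) (mixedEmbedding.mixedSpace L))).map
          (UnitaryGroup.evalC L w) =
      !![(g.map (UnitaryGroup.evalC L w)) 0 0, 0, (g.map (UnitaryGroup.evalC L w)) 0 1;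
        0, UnitaryGroup.evalC L w (u 0 0), 0;
        (g.map (UnitaryGroup.evalC L w)) 1 0, 0, (g.map (UnitaryGroup.evalC L w)) 1 1] := by
    rw [coe_endoEmbArch, coe_endoGL_eq]
    ext i j
    fin_cases i <;> fin_cases j <;> simp [Matrix.map_apply, hg, hu]
  refine ⟨cw *ᵥ Pi.single 1 (UnitaryGroup.evalC L w (u 0 0) * UnitaryGroup.evalC L w (u 0 0) -
      (g.map (UnitaryGroup.evalC L w)).trace * UnitaryGroup.evalC L w (u 0 0) + (g.map (UnitaryGroup.evalC L w)).det),
    Pi.single 1 1 ᵥ* cw', ?_⟩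
  dsimp only [archEigenlineProjector]
  rw [← hg, hmat, Matrix.map_mul, Matrix.map_mul, hι, ← hcw, ← hcw', conj_mul_sq_sub_smul_add_smul_one cw cw' _ _ _ h1 h2,
    endoPattern_sq_sub_trace_smul_add_det_smul_one (g.map (UnitaryGroup.evalC L w)) (UnitaryGroup.evalC L w (u 0 0)),
    mul_vecMulVec, vecMulVec_mul]

/-! ## §3 `κ_w`, matching and `Δ″_∞` are class functions of `γ′` -/

/-- **`κ_w(γ_H, yγ′y⁻¹) = κ_w(γ_H, γ′)` on matching pairs**: `tr(P′ᴴ w(H′) P′) = tr((P y_w⁻¹)ᴴ w(H′) (P y_w⁻¹))` by unitarity of `y_w`, and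
the sign of that trace is a congruence invariant because `P = P_w(γ_H, γ′)` has rank `≤ 1` (§1, §2).
[cite: Rogawski1990, §14.6 p. 242] [cite: LanglandsShelstad1987, §2] -/
theorem archKappaAt_conj_right (h : IsArchNormPair L H' a b) :
    archKappaAt L H' a w (y * b * y⁻¹) = archKappaAt L H' a w b := by
  obtain ⟨p, q, hP⟩ := archEigenlineProjector_eq_vecMulVec_of_isArchNormPair L H' a b w h
  unfold archKappaAt
  rw [archEigenlineProjector_conj_right, hP]
  set yw := ((y : GL (Fin 3) (mixedEmbedding.mixedSpace L)) : Matrix (Fin 3) (Fin 3) (mixedEmbedding.mixedSpace L)).map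
    (UnitaryGroup.evalC L w) with hyw
  set yw' := (((y : GL (Fin 3) (mixedEmbedding.mixedSpace L))⁻¹ : GL (Fin 3) (mixedEmbedding.mixedSpace L)) :
    Matrix (Fin 3) (Fin 3) (mixedEmbedding.mixedSpace L)).map (UnitaryGroup.evalC L w) with hyw'
  have hH : ywᴴ * H'.map w.1.embedding * yw = H'.map w.1.embedding := conjTranspose_map_evalC_mul_form_mul L H' y w
  have hcong : (yw * vecMulVec p q * yw')ᴴ * H'.map w.1.embedding * (yw * vecMulVec p q * yw') =
      ((1 : ℂ) • vecMulVec p q * yw')ᴴ * H'.map w.1.embedding * ((1 : ℂ) • vecMulVec p q * yw') := by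
    rw [one_smul, Matrix.mul_assoc yw, conjTranspose_mul]
    calc (vecMulVec p q * yw')ᴴ * ywᴴ * H'.map w.1.embedding * (yw * (vecMulVec p q * yw'))
        = (vecMulVec p q * yw')ᴴ * (ywᴴ * H'.map w.1.embedding * yw) * (vecMulVec p q * yw') := by
          simp only [Matrix.mul_assoc]
      _ = (vecMulVec p q * yw')ᴴ * H'.map w.1.embedding * (vecMulVec p q * yw') := by rw [hH]
  have h1 : ((1 : ℂ) • vecMulVec p q)ᴴ * H'.map w.1.embedding * ((1 : ℂ) • vecMulVec p q) =
      (vecMulVec p q)ᴴ * H'.map w.1.embedding * vecMulVec p q := by rw [one_smul]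
  rw [hcong, sign_re_trace_rankOne_mul_eq 1 p q (H'.map w.1.embedding) yw' yw (map_evalC_inv_mul L H' y w), h1]

/-- **`ι(γ_H) ↔ yγ′y⁻¹` iff `ι(γ_H) ↔ γ′`** — matching only sees the (stable) class of `γ′` (★ `Corresponds.of_isStablyConj_right`).
[cite: Rogawski1990, §14.1 p. 232] -/
theorem isArchNormPair_conj_right : IsArchNormPair L H' a (y * b * y⁻¹) ↔ IsArchNormPair L H' a b := by
  rw [isArchNormPair_iff, isArchNormPair_iff]
  have hst : IsStablyConj (UnitaryGroup.conjMixed (↥(maximalRealSubfield L)) L (IsCMField.complexConj L))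
      (UnitaryGroup.archFormOf L 3 H') b (y * b * y⁻¹) :=
    isStablyConj_of_isConj (isConj_iff.2 ⟨y, rfl⟩)
  exact ⟨fun h => h.of_isStablyConj_right hst.symm, fun h => h.of_isStablyConj_right hst⟩

end ConjRight

section Head

variable (L : Type) [Field L] [NumberField L] [IsCMField L] (H' : Matrix (Fin 3) (Fin 3) L)

open scoped Classical in
/-- **N1a-r: `Δ″_∞(γ_H, yγ′y⁻¹) = Δ″_∞(γ_H, γ′)`** — invariance under conjugation of `γ′` in `G′_∞ = U(H′)(L⁺ ⊗ ℝ)` (the `conj_right`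
field of ★ `TransferFactorData`; the type of the hypothesis `hr` of ★ `archExplicitTransferFactor`, token for token), so that
`archExplicitTransferFactor L H′ μ (archExplicitDelta_conj_left L H′ μ) (archExplicitDelta_conj_right L H′ μ)` is print's `Δ″_∞` as an
unconditional ★ `ArchTransferFactor L H′`. [cite: Rogawski1990, §4.9 p. 55; §4.3 p. 43; §14.6 p. 242] -/
theorem archExplicitDelta_conj_right (μ : HeckeCharacter L) :
    ∀ (a : ↥(UnitaryGroup.arch (↥(maximalRealSubfield L)) L (IsCMField.complexConj L) 2
            (Matrix.of fun i j : Fin 2 => if i.val + j.val + 1 = 2 then (1 : L) else 0)) ×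
          ↥(UnitaryGroup.arch (↥(maximalRealSubfield L)) L (IsCMField.complexConj L) 1
            (Matrix.of fun i j : Fin 1 => if i.val + j.val + 1 = 1 then (1 : L) else 0)))
      (b y : ↥(UnitaryGroup.arch (↥(maximalRealSubfield L)) L (IsCMField.complexConj L) 3 H')),
      archExplicitDelta L H' a μ (y * b * y⁻¹) = archExplicitDelta L H' a μ b := by
  intro a b y
  by_cases h : IsArchNormPair L H' a b
  · rw [archExplicitDelta_of_isArchNormPair L H' a μ ((isArchNormPair_conj_right L H' a b y).2 h),
      archExplicitDelta_of_isArchNormPair L H' a μ h]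
    have hk : (∏ w : {w : InfinitePlace L // IsComplex w}, archKappaAt L H' a w (y * b * y⁻¹)) =
        ∏ w : {w : InfinitePlace L // IsComplex w}, archKappaAt L H' a w b :=
      Finset.prod_congr rfl fun w _ => archKappaAt_conj_right L H' a b y w h
    rw [hk]
  · rw [archExplicitDelta_of_not_isArchNormPair L H' a μ (fun h' => h ((isArchNormPair_conj_right L H' a b y).1 h')),
      archExplicitDelta_of_not_isArchNormPair L H' a μ h]

/-- **Print's `Δ″_∞` is an unconditional ★ `ArchTransferFactor`**: both invariance hypotheses of ★ `archExplicitTransferFactor` are now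
theorems; this records the resulting factor's `Δ` (no new definition — the term is ★ `archExplicitTransferFactor` applied to the two
theorems). [cite: Rogawski1990, §4.9 p. 55; §14.6 p. 242] -/
theorem archExplicitTransferFactor_Δ_eq (μ : HeckeCharacter L)
    (a : ↥(UnitaryGroup.arch (↥(maximalRealSubfield L)) L (IsCMField.complexConj L) 2
            (Matrix.of fun i j : Fin 2 => if i.val + j.val + 1 = 2 then (1 : L) else 0)) ×
          ↥(UnitaryGroup.arch (↥(maximalRealSubfield L)) L (IsCMField.complexConj L) 1
            (Matrix.of fun i j : Fin 1 => if i.val + j.val + 1 = 1 then (1 : L) else 0)))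
    (b : ↥(UnitaryGroup.arch (↥(maximalRealSubfield L)) L (IsCMField.complexConj L) 3 H')) :
    (archExplicitTransferFactor L H' μ (archExplicitDelta_conj_left L H' μ) (archExplicitDelta_conj_right L H' μ)).Δ a b =
      archExplicitDelta L H' a μ b :=
  rfl

end Head

end Literature.NumberTheory.Rogawski1990

end
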